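import Summits.CriticalPhenomena.PercolationContinuityZ3.Theorems.Transplant.SkelPhiSeedSlabKit
import Summits.CriticalPhenomena.PercolationContinuityZ3.Theorems.Transplant.SkelSlabCube
import HarnessLib

/-!
# D″ node, φ-level generic layer ((B″), DPRIME-SCOPE wave (4) "rooms over rectangles", K.4 leftover `SkelSlabCube`): the near-contact face
# conditions `Skelφ.NearFaceOKDeep` of the DEEP seed slab are met by the NEAR SIDE of p3-g7's KIT RECTANGLE behind the slab
# (`Skelφ.nearSide` of `SkelPhiRectAt`), and the rectangle and its near side lie in the Step-V SHELL window — φ-level re-cut of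
# `SkelSlabCube` (p237288, p3-g4) with the Lemma-9 cube `fatSeq (cubeCtr …) M` / quarter face `cubeFace` replaced by the band rectangle
# `rectPrism (rectCtr …) a R` / directed side `rside` (ruling (U1′): the kit is a rectangle whose half-widths depend on the exit axis)

builds on p205010 (kernel theorem, internal audit signed; external expert review pending) — nothing in this file uses p205010.
Lane `prim-bschramm`, seat `prim-bschramm-p1` (gen 9; claim lane INBOX 2026-08-21 ≈04:25Z); helper file (`--supports stmt-CriticalPhenomena-4575 --as helper`).

For a candidate contact `x` of the window level `j` (`Lo = lo − j`, `Hi = hi + j`) with inner neighbour `y = inNbr … x`, exit datum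
`(i, σ) = exitDir … x` and deep slab centre `t = deepCtr … x` (`φ t i = φ y i − σ(ℓs+1)`, `Lo + T₀ ≤ φ t (oth i) ≤ Hi − T₀`, `T₀ = tanOff ℓs M`,
`d_G(y, t) ≤ ℓs + 1 + T₀`), the face is **`rectU x := nearSide G hstep t i σ ℓs (A i) (Rk i)`** — the near side (`φ_i = φ_i t − σ(ℓs+1)`,
transverse offset `≤ A i (oth i)`) of the fat rectangle `rectPrism (rectCtr hstep t i σ ℓs (A i)) (A i) (Rk i)` stacked behind the slab; the
half-widths `A i : Fin 2 → ℕ` and the radius `Rk i` may depend on the exit axis `i` (x-facing contacts get `R_x`, y-facing `R_y`).  ROOM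
hypotheses: `hA : ∀ i k, A i k ≤ M` (the slab's tangential depth `T₀ − (2ℓs+2) = M` and the level box sides `≥ 2T₀` cover the rectangle),
`hAℓ : ∀ i, A i (oth i) ≤ ℓs` (the rung from a side vertex lands in the slab cylinder), `hK : ∀ i, ℓs + 1 + A i i + Rk i ≤ K` (one reach constant).
* §1 `rectU`, `nearSide_slab_geom` (abstract slab centre), **`rectU_geom`** (face in `B_G(x, ℓs+2+T₀+K)`, `B_G(y, ℓs+1+T₀+K)`, SHELL box);
* §2 **`rectPrism_subset_shellWin`** (near contact: the whole kit rectangle lies in the shell window `Win w₀ (Icc (Lo+(2ℓs+2)) (Hi−(2ℓs+2))) R` —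
  the `hQS : Q ⊆ S` of `KNLevels.stepIV_in`);
* §3 `nearSide_subset_innerBoundary` (any exploration graph making the rungs edges), **`rectU_subset_innerBoundary_win`** (the `hUib`);
* §4 **`nearFaceOK_rect`**, **`kitOK_slabRect`** (= `kitOK_slabDeep` ∘ `nearFaceOK_rect`; the cylinder-ball radius from `Frames` + (κ)).
The Φ-free `SkelI.mem_Icc_of_mem_shell` is imported from `SkelSlabCube` (K2.5).
[cite: KozmaNitzan2024, §4 p. 19 (Step III: seeds and the plaquette behind a contact), p. 21 (U(P) ⊆ ∂Q, "Q ⊆ S", v(P) + Λ_M behind P)]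
-/

noncomputable section

open scoped Classical

namespace Summit.CriticalPhenomena.PercolationContinuityZ3.Theorems.Transplant

namespace Skelφ

open Literature.Probability.Percolation Literature.Probability.LatticeModels SimpleGraph KNLevels
open Literature.Barriers.CriticalPhenomena (graphBall graphBall_finite mem_graphBall_self graphBall_mono)
open Literature.Probability.Percolation.KozmaNitzan.Cells (oth oth_ne eq_oth_of_ne oth_oth)
open Skel (winGraph winGraph_adj KitGeom)
open SkelI (tanOff tanTgt tanTgt_mem deepPt)

variable {V : Type} {G : SimpleGraph V} [G.LocallyFinite] {φ : V → Site 2}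

/-! ## §1 The near side of the kit rectangle behind the deep slab of a contact -/

/-- **The face of a near contact `x` of the window level `j`**: the near side of the kit rectangle with half-widths `A i`, radius `Rk i`,
stacked `ℓs + 1 + A i i` inward of the deep slab centre `deepCtr … x` along the exit datum `(i, σ) = exitDir … x`.
[cite: KozmaNitzan2024, §4 p. 21 (U(P): the boundary plaquettes of v(P) + Λ_M facing P)] -/
def rectU (hstep : Steps G φ) (w₀ : V) (R : ℕ) (lo hi : Site 2) (j ℓs M : ℕ) (A : Fin 2 → Fin 2 → ℕ) (Rk : Fin 2 → ℕ) (x : V) :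
    Finset V :=
  nearSide G hstep (deepCtr G φ w₀ R (lo - (j : Site 2)) (hi + (j : Site 2)) ℓs M x)
    (exitDir G φ w₀ R (lo - (j : Site 2)) (hi + (j : Site 2)) x).1 (exitDir G φ w₀ R (lo - (j : Site 2)) (hi + (j : Site 2)) x).2 ℓs
    (A (exitDir G φ w₀ R (lo - (j : Site 2)) (hi + (j : Site 2)) x).1) (Rk (exitDir G φ w₀ R (lo - (j : Site 2)) (hi + (j : Site 2)) x).1)

/-- **Geometry of a near side behind a slab centre `t`** (abstract): `y` adjacent to `x`, `t` within graph distance `D` of `y`; every vertex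
`u` of `nearSide G hstep t i σ ℓs a Rr` lies in `B_G(x, D + ℓs + 2 + a i + Rr)` and in `B_G(y, D + ℓs + 1 + a i + Rr)`, with exit coordinate
`φ u i = φ t i − σ(ℓs+1)` and transverse offset `≤ a (oth i)`. [cite: KozmaNitzan2024, §4 p. 21 (v(P) + Λ_M ⊆ S)] -/
theorem nearSide_slab_geom (hstep : Steps G φ) {x y t : V} {i : Fin 2} {σ : ℤˣ} {ℓs D : ℕ} {a : Fin 2 → ℕ} {Rr : ℕ} (hadj : G.Adj x y)
    (hty : t ∈ graphBall G y D) {u : V} (hu : u ∈ nearSide G hstep t i σ ℓs a Rr) :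
    u ∈ graphBall G x (D + ℓs + 2 + a i + Rr) ∧ u ∈ graphBall G y (D + ℓs + 1 + a i + Rr) ∧
      φ u i = φ t i - (σ : ℤ) * (ℓs + 1) ∧ |φ u (oth i) - φ t (oth i)| ≤ a (oth i) := by
  have hut := nearSide_subset_graphBall hstep t i σ ℓs a Rr hu
  have huy : u ∈ graphBall G y (D + ℓs + 1 + a i + Rr) :=
    graphBall_mono G y (by omega) (BoxProdZ2.mem_graphBall_add G hty hut)
  exact ⟨graphBall_mono G x (by omega) (BoxProdZ2.mem_graphBall_add G
    (BoxProdZ2.mem_graphBall_succ_of_adj G (mem_graphBall_self G x 0) hadj) huy), huy, φ_nearSide hstep t i σ ℓs a Rr hu⟩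

section Near

variable [DecidableEq V] {w₀ : V} {R : ℕ} {lo hi : Site 2} {j ℓs M : ℕ} {A : Fin 2 → Fin 2 → ℕ} {Rk : Fin 2 → ℕ} {K : ℕ}

/-- **Geometry of the face of a contact** `x` of the window level `j` (deep slab, box sides `≥ 2T₀`, half-widths `≤ M`, reach `K`): every vertex
of `rectU … x` lies in `B_G(x, ℓs + 2 + T₀ + K)`, in `B_G(inNbr x, ℓs + 1 + T₀ + K)`, and in the SHELL BOX `Icc (Lo + (2ℓs+2)) (Hi − (2ℓs+2))`
(exit coordinate `φ y i − σ(2ℓs+2)` with `φ y i` on the `σ`-face; transverse coordinate within `M` of `φ t (oth i) ∈ [Lo + T₀, Hi − T₀]`,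
`T₀ − M = 2ℓs + 2`). [cite: KozmaNitzan2024, §4 p. 21] -/
theorem rectU_geom (hlip : Lip G φ) (hstep : Steps G φ) (hwide : ∀ i, (lo - (j : Site 2)) i + 2 * tanOff ℓs M ≤ (hi + (j : Site 2)) i) (hA : ∀ i k, A i k ≤ M)
    (hK : ∀ i, ℓs + 1 + A i i + Rk i ≤ K) {x : V} (hx : x ∈ outerBoundary (winGraph G w₀ R) (winLevel G φ w₀ R lo hi j)) {u : V}
    (hu : u ∈ rectU hstep w₀ R lo hi j ℓs M A Rk x) :
    u ∈ graphBall G x (ℓs + 2 + tanOff ℓs M + K) ∧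
      u ∈ graphBall G (inNbr G φ w₀ R (Finset.Icc (lo - (j : Site 2)) (hi + (j : Site 2))) x) (ℓs + 1 + tanOff ℓs M + K) ∧
      φ u ∈ Finset.Icc (lo - (j : Site 2) + ((2 * ℓs + 2 : ℕ) : Site 2)) (hi + (j : Site 2) - ((2 * ℓs + 2 : ℕ) : Site 2)) := by
  have hx' : x ∈ outerBoundary (winGraph G w₀ R) (Win G φ w₀ (Finset.Icc (lo - (j : Site 2)) (hi + (j : Site 2))) R) := hx
  obtain ⟨hadj, -, hyP⟩ := inNbr_spec hx'
  have hty := (deepCtr_spec hstep (ℓs := ℓs) (M := M) hwide hyP).1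
  have hexit := φ_deepCtr_exit hstep (ℓs := ℓs) (M := M) hwide hyP
  have htan := φ_deepCtr_tan hstep (ℓs := ℓs) (M := M) hwide hyP
  have htgt := tanTgt_mem (Lo := lo - (j : Site 2)) (Hi := hi + (j : Site 2)) (ℓs := ℓs) (M := M)
    (oth (exitDir G φ w₀ R (lo - (j : Site 2)) (hi + (j : Site 2)) x).1) (hwide _)
    (φ (inNbr G φ w₀ R (Finset.Icc (lo - (j : Site 2)) (hi + (j : Site 2))) x))
  have hspec := exitDir_spec hlip hx'
  have hAi := hA (exitDir G φ w₀ R (lo - (j : Site 2)) (hi + (j : Site 2)) x).1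
  have hKi := hK (exitDir G φ w₀ R (lo - (j : Site 2)) (hi + (j : Site 2)) x).1
  rw [rectU] at hu
  obtain ⟨hux, huy, hexI, htr⟩ := nearSide_slab_geom hstep hadj hty hu
  refine ⟨graphBall_mono G x (by omega) hux, graphBall_mono G _ (by omega) huy, ?_⟩
  -- abstract the slab data: exit coordinate, sign, centre, inner neighbour, half-widths
  generalize hI : (exitDir G φ w₀ R (lo - (j : Site 2)) (hi + (j : Site 2)) x).1 = I at hexit htan htgt hspec hexI htr hAi
  generalize hS : (exitDir G φ w₀ R (lo - (j : Site 2)) (hi + (j : Site 2)) x).2 = sg at hexit hspec hexI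
  generalize hT : deepCtr G φ w₀ R (lo - (j : Site 2)) (hi + (j : Site 2)) ℓs M x = t at hexit htan hexI htr
  generalize hY : inNbr G φ w₀ R (Finset.Icc (lo - (j : Site 2)) (hi + (j : Site 2))) x = y at hyP hexit htan htgt hspec
  generalize hτ : tanTgt (lo - (j : Site 2)) (hi + (j : Site 2)) ℓs M (oth I) (φ y) = τ at htan htgt
  generalize hB : A I = a at hexI htr hAi
  rw [Finset.mem_Icc] at hyP
  obtain ⟨hyl, hyh⟩ := hyP
  have hT₀ : (tanOff ℓs M : ℤ) = 2 * ℓs + 2 + M := by simp [tanOff]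
  have hwI := hwide I
  have haM : ((a (oth I) : ℕ) : ℤ) ≤ M := by exact_mod_cast hAi (oth I)
  have htr' := abs_le.1 htr
  -- the exit coordinate: `φ u I = φ y I - sg (2ℓs + 2)` with `φ y I` on the `sg`-face
  have huI : (lo - (j : Site 2)) I + (2 * ℓs + 2 : ℕ) ≤ φ u I ∧ φ u I ≤ (hi + (j : Site 2)) I - (2 * ℓs + 2 : ℕ) := by
    rcases hspec with ⟨rfl, hf⟩ | ⟨rfl, hf⟩ <;> push_cast at hexI hexit ⊢ <;> constructor <;> linarith
  -- the transverse coordinate: `φ t (oth I) = τ ∈ [Lo + T₀, Hi - T₀]`, `|φ u - φ t| ≤ a ≤ M`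
  have huO : (lo - (j : Site 2)) (oth I) + (2 * ℓs + 2 : ℕ) ≤ φ u (oth I) ∧
      φ u (oth I) ≤ (hi + (j : Site 2)) (oth I) - (2 * ℓs + 2 : ℕ) := by
    push_cast at htgt ⊢
    rw [htan] at htr'
    constructor <;> linarith [htgt.1, htgt.2, htr'.1, htr'.2]
  rw [Finset.mem_Icc]
  constructor <;> intro k
  · have goal : (lo - (j : Site 2) + ((2 * ℓs + 2 : ℕ) : Site 2)) k ≤ φ u k := by
      rw [Pi.add_apply, Pi.natCast_apply]
      by_cases hk : k = I
      · rw [hk]; exact huI.1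
      · rw [eq_oth_of_ne hk]; exact huO.1
    exact goal
  · have goal : φ u k ≤ (hi + (j : Site 2) - ((2 * ℓs + 2 : ℕ) : Site 2)) k := by
      rw [Pi.sub_apply, Pi.natCast_apply]
      by_cases hk : k = I
      · rw [hk]; exact huI.2
      · rw [eq_oth_of_ne hk]; exact huO.2
    exact goal

/-- The faces of ALL candidate contacts lie in the shell box (the `hUsh` of `Skelφ.slabSeedDeep_notMem_wireSet` and of the kit clause).
[cite: KozmaNitzan2024, §4 p. 21 ("Q ⊆ S")] -/
theorem rectU_mem_shellBox (hlip : Lip G φ) (hstep : Steps G φ) (hwide : ∀ i, (lo - (j : Site 2)) i + 2 * tanOff ℓs M ≤ (hi + (j : Site 2)) i) (hA : ∀ i k, A i k ≤ M)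
    (hK : ∀ i, ℓs + 1 + A i i + Rk i ≤ K) :
    ∀ x ∈ outerBoundary (winGraph G w₀ R) (winLevel G φ w₀ R lo hi j), ∀ u ∈ rectU hstep w₀ R lo hi j ℓs M A Rk x,
      φ u ∈ Finset.Icc (lo - (j : Site 2) + ((2 * ℓs + 2 : ℕ) : Site 2)) (hi + (j : Site 2) - ((2 * ℓs + 2 : ℕ) : Site 2)) :=
  fun _ hx _ hu => (rectU_geom hlip hstep hwide hA hK hx hu).2.2

/-! ## §2 The kit rectangle of a near contact lies in the shell window -/

/-- **The kit rectangle behind the deep slab of a NEAR contact lies in the shell window** `Win w₀ (Icc (Lo + (2ℓs+2)) (Hi − (2ℓs+2))) R`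
(`y ∈ B_G(w₀, R − r₀)` with `r₀ ≥ ℓs + 1 + T₀ + K`, box sides `≥ 2T₀`, half-widths `≤ M`): the `hQS : Q ⊆ S` of Step IV with `S ⊇` the shell
window. [cite: KozmaNitzan2024, §4 p. 21 ("Q ⊆ S")] -/
theorem rectPrism_subset_shellWin (hlip : Lip G φ) (hstep : Steps G φ) {r₀ : ℕ} (hwide : ∀ i, (lo - (j : Site 2)) i + 2 * tanOff ℓs M ≤ (hi + (j : Site 2)) i)
    (hA : ∀ i k, A i k ≤ M) (hK : ∀ i, ℓs + 1 + A i i + Rk i ≤ K) (hr₀ : ℓs + 1 + tanOff ℓs M + K ≤ r₀) (hR : r₀ ≤ R) {x : V}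
    (hx : x ∈ outerBoundary (winGraph G w₀ R) (winLevel G φ w₀ R lo hi j))
    (hnear : inNbr G φ w₀ R (Finset.Icc (lo - (j : Site 2)) (hi + (j : Site 2))) x ∈ graphBall G w₀ (R - r₀)) :
    rectPrismFin G φ (rectCtr hstep (deepCtr G φ w₀ R (lo - (j : Site 2)) (hi + (j : Site 2)) ℓs M x)
        (exitDir G φ w₀ R (lo - (j : Site 2)) (hi + (j : Site 2)) x).1 (exitDir G φ w₀ R (lo - (j : Site 2)) (hi + (j : Site 2)) x).2 ℓs
        (A (exitDir G φ w₀ R (lo - (j : Site 2)) (hi + (j : Site 2)) x).1))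
        (A (exitDir G φ w₀ R (lo - (j : Site 2)) (hi + (j : Site 2)) x).1) (Rk (exitDir G φ w₀ R (lo - (j : Site 2)) (hi + (j : Site 2)) x).1) ⊆
      Win G φ w₀ (Finset.Icc (lo - (j : Site 2) + ((2 * ℓs + 2 : ℕ) : Site 2)) (hi + (j : Site 2) - ((2 * ℓs + 2 : ℕ) : Site 2))) R := by
  have hx' : x ∈ outerBoundary (winGraph G w₀ R) (Win G φ w₀ (Finset.Icc (lo - (j : Site 2)) (hi + (j : Site 2))) R) := hx
  obtain ⟨-, -, hyP⟩ := inNbr_spec hx'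
  have hty := (deepCtr_spec hstep (ℓs := ℓs) (M := M) hwide hyP).1
  have hexit := φ_deepCtr_exit hstep (ℓs := ℓs) (M := M) hwide hyP
  have htan := φ_deepCtr_tan hstep (ℓs := ℓs) (M := M) hwide hyP
  have htgt := tanTgt_mem (Lo := lo - (j : Site 2)) (Hi := hi + (j : Site 2)) (ℓs := ℓs) (M := M)
    (oth (exitDir G φ w₀ R (lo - (j : Site 2)) (hi + (j : Site 2)) x).1) (hwide _)
    (φ (inNbr G φ w₀ R (Finset.Icc (lo - (j : Site 2)) (hi + (j : Site 2))) x))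
  have hspec := exitDir_spec hlip hx'
  have hAi := hA (exitDir G φ w₀ R (lo - (j : Site 2)) (hi + (j : Site 2)) x).1
  have hKi := hK (exitDir G φ w₀ R (lo - (j : Site 2)) (hi + (j : Site 2)) x).1
  have hc := rectCtr_spec hstep (deepCtr G φ w₀ R (lo - (j : Site 2)) (hi + (j : Site 2)) ℓs M x)
    (exitDir G φ w₀ R (lo - (j : Site 2)) (hi + (j : Site 2)) x).1 (exitDir G φ w₀ R (lo - (j : Site 2)) (hi + (j : Site 2)) x).2 ℓs
    (A (exitDir G φ w₀ R (lo - (j : Site 2)) (hi + (j : Site 2)) x).1)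
  have hφc := φ_rectCtr hstep (deepCtr G φ w₀ R (lo - (j : Site 2)) (hi + (j : Site 2)) ℓs M x)
    (exitDir G φ w₀ R (lo - (j : Site 2)) (hi + (j : Site 2)) x).1 (exitDir G φ w₀ R (lo - (j : Site 2)) (hi + (j : Site 2)) x).2 ℓs
    (A (exitDir G φ w₀ R (lo - (j : Site 2)) (hi + (j : Site 2)) x).1)
  intro v hv
  rw [mem_rectPrismFin] at hv
  rw [mem_Win]
  refine ⟨?_, ?_⟩
  · -- depth: `c` within `(ℓs+1+T₀) + (ℓs+1+A i i)` of `y`, `v` within `Rk i` of `c`, `y` within `R - r₀` of `w₀`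
    have hcy := BoxProdZ2.mem_graphBall_add G hty hc.1
    have hcw := BoxProdZ2.mem_graphBall_add G hnear hcy
    exact graphBall_mono G w₀ (by omega) (BoxProdZ2.mem_graphBall_add G hcw (rectPrism_subset_graphBall G φ _ _ _ hv))
  · -- planar: the rectangle's box about `φ c` lies in the shell box
    have hb := mem_abox.1 (rectPrism_subset_rcyl G φ _ _ _ hv)
    generalize hI : (exitDir G φ w₀ R (lo - (j : Site 2)) (hi + (j : Site 2)) x).1 = I at hexit htan htgt hspec hφc hb hAi
    generalize hS : (exitDir G φ w₀ R (lo - (j : Site 2)) (hi + (j : Site 2)) x).2 = sg at hexit hspec hφc hb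
    generalize hB : A I = a at hφc hb hAi
    generalize hC' : rectCtr hstep (deepCtr G φ w₀ R (lo - (j : Site 2)) (hi + (j : Site 2)) ℓs M x) I sg ℓs a = c at hφc hb
    generalize hT : deepCtr G φ w₀ R (lo - (j : Site 2)) (hi + (j : Site 2)) ℓs M x = t at hexit htan hφc
    generalize hY : inNbr G φ w₀ R (Finset.Icc (lo - (j : Site 2)) (hi + (j : Site 2))) x = y at hyP hexit htan htgt hspec
    generalize hτ : tanTgt (lo - (j : Site 2)) (hi + (j : Site 2)) ℓs M (oth I) (φ y) = τ at htan htgt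
    rw [Finset.mem_Icc] at hyP
    obtain ⟨hyl, hyh⟩ := hyP
    obtain ⟨hcI, hcO⟩ := hφc
    have hT₀ : (tanOff ℓs M : ℤ) = 2 * ℓs + 2 + M := by simp [tanOff]
    have hwI := hwide I
    have hwO := hwide (oth I)
    have hbI := hb I
    have hbO := hb (oth I)
    simp only [Pi.sub_apply] at hbI hbO
    have haI : ((a I : ℕ) : ℤ) ≤ M := by exact_mod_cast hAi I
    have haO : ((a (oth I) : ℕ) : ℤ) ≤ M := by exact_mod_cast hAi (oth I)
    have hI' : (lo - (j : Site 2)) I + (2 * ℓs + 2 : ℕ) ≤ φ v I ∧ φ v I ≤ (hi + (j : Site 2)) I - (2 * ℓs + 2 : ℕ) := by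
      rcases hspec with ⟨rfl, hf⟩ | ⟨rfl, hf⟩ <;> push_cast at hcI hexit ⊢ <;> constructor <;> linarith [hbI.1, hbI.2, haI]
    have hO' : (lo - (j : Site 2)) (oth I) + (2 * ℓs + 2 : ℕ) ≤ φ v (oth I) ∧
        φ v (oth I) ≤ (hi + (j : Site 2)) (oth I) - (2 * ℓs + 2 : ℕ) := by
      push_cast at htgt ⊢
      rw [htan] at hcO
      constructor <;> linarith [htgt.1, htgt.2, hbO.1, hbO.2]
    rw [Finset.mem_Icc]
    constructor <;> intro k
    · have goal : (lo - (j : Site 2) + ((2 * ℓs + 2 : ℕ) : Site 2)) k ≤ φ v k := by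
        rw [Pi.add_apply, Pi.natCast_apply]
        by_cases hk : k = I
        · rw [hk]; exact hI'.1
        · rw [eq_oth_of_ne hk]; exact hO'.1
      exact goal
    · have goal : φ v k ≤ (hi + (j : Site 2) - ((2 * ℓs + 2 : ℕ) : Site 2)) k := by
        rw [Pi.sub_apply, Pi.natCast_apply]
        by_cases hk : k = I
        · rw [hk]; exact hI'.2
        · rw [eq_oth_of_ne hk]; exact hO'.2
      exact goal

end Near

/-! ## §3 The near side lies on the inner boundary of the kit rectangle -/

/-- **The near side lies on the inner boundary of the kit rectangle in the exploration graph `Γ`** (`hUib` of Step IV): every side vertex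
`u` has its outward `Steps`-neighbour `v` in the slab cylinder `cyl(t, ℓs)`, hence outside the rectangle (coordinate `i` separates: the
rectangle's `i`-coordinates are `≥ ℓs + 1` away from `φ t i`), and `u — v` is a `Γ`-edge by hypothesis.
[cite: KozmaNitzan2024, §4 p. 21 (U(P) ⊆ ∂Q)] -/
theorem nearSide_subset_innerBoundary [DecidableEq V] (hstep : Steps G φ) {types : Finset V} (hfr : Frames G φ types)
    (hκ : CylConn G φ types) {Γ : SimpleGraph V} [Γ.LocallyFinite] {t : V} {i : Fin 2} {σ : ℤˣ} {ℓs : ℕ} {a : Fin 2 → ℕ} {Rr : ℕ}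
    (hℓs : 1 ≤ ℓs) (ha : a (oth i) ≤ ℓs)
    (hΓ : ∀ u ∈ nearSide G hstep t i σ ℓs a Rr, ∀ v ∈ cylBall G φ t ℓs (cylRadMax G φ types ℓs (ℓs + 2 + a i + Rr)),
      G.Adj v u → Γ.Adj u v) :
    nearSide G hstep t i σ ℓs a Rr ⊆ innerBoundary Γ (rectPrismFin G φ (rectCtr hstep t i σ ℓs a) a Rr) := by
  intro u hu
  rw [mem_innerBoundary_iff]
  refine ⟨nearSide_subset_rectPrismFin hstep t i σ ℓs a Rr hu, ?_⟩
  obtain ⟨v, hv, hvu⟩ := exists_step_mem_cylBall_of_mem_nearSide hstep t i σ ℓs a Rr hfr hκ hℓs ha hu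
  refine ⟨v, fun hvc => ?_, hΓ u hu v hv hvu⟩
  have hvt : φ v - φ t ∈ box 2 ℓs := (mem_cyl φ t ℓs v).1 (cylBall_subset_cyl G φ t ℓs _ hv)
  have hvrect : φ v - φ (rectCtr hstep t i σ ℓs a) ∈ abox a :=
    rectPrism_subset_rcyl G φ _ a Rr ((mem_rectPrismFin G φ).1 hvc)
  have hc := (φ_rectCtr hstep t i σ ℓs a).1
  have h1 := (mem_box.1 hvt) i
  have h2 := (mem_abox.1 hvrect) i
  simp only [Pi.sub_apply] at h1 h2
  rcases Int.units_eq_one_or σ with rfl | rfl <;> push_cast at hc <;> omega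

section NearWin

variable [DecidableEq V] {types : Finset V} {w₀ : V} {R : ℕ} {lo hi : Site 2} {j ℓs M : ℕ} {A : Fin 2 → Fin 2 → ℕ} {Rk : Fin 2 → ℕ}
  {K : ℕ}

/-- **The face of a near contact lies on the inner boundary of its kit rectangle in the window graph** `winGraph G w₀ R` (the `hUib` for
the plain window graph): `y ∈ B_G(w₀, R − r₀)` with `r₀ ≥ ℓs + 1 + T₀ + R'`, `r₀ ≥ ℓs + 2 + T₀ + K`, `R' ≥ cylRadMax ℓs (ℓs + 2 + A i i + Rk i)`
put the face and the slab cylinder inside the ball, so the rung edges are window-graph edges. [cite: KozmaNitzan2024, §4 p. 21 (U(P) ⊆ ∂Q)] -/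
theorem rectU_subset_innerBoundary_win (hlip : Lip G φ) (hstep : Steps G φ) (hfr : Frames G φ types) (hκ : CylConn G φ types)
    {R' r₀ : ℕ} (hℓs : 1 ≤ ℓs)
    (hwide : ∀ i, (lo - (j : Site 2)) i + 2 * tanOff ℓs M ≤ (hi + (j : Site 2)) i) (hA : ∀ i k, A i k ≤ M) (hAℓ : ∀ i, A i (oth i) ≤ ℓs)
    (hK : ∀ i, ℓs + 1 + A i i + Rk i ≤ K) (hR' : ∀ i, cylRadMax G φ types ℓs (ℓs + 2 + A i i + Rk i) ≤ R')
    (hr₀₁ : ℓs + 1 + tanOff ℓs M + R' ≤ r₀) (hr₀₂ : ℓs + 2 + tanOff ℓs M + K ≤ r₀) (hR : r₀ ≤ R) {x : V}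
    (hx : x ∈ outerBoundary (winGraph G w₀ R) (winLevel G φ w₀ R lo hi j))
    (hnear : inNbr G φ w₀ R (Finset.Icc (lo - (j : Site 2)) (hi + (j : Site 2))) x ∈ graphBall G w₀ (R - r₀)) :
    rectU hstep w₀ R lo hi j ℓs M A Rk x ⊆ innerBoundary (winGraph G w₀ R)
      (rectPrismFin G φ (rectCtr hstep (deepCtr G φ w₀ R (lo - (j : Site 2)) (hi + (j : Site 2)) ℓs M x)
        (exitDir G φ w₀ R (lo - (j : Site 2)) (hi + (j : Site 2)) x).1 (exitDir G φ w₀ R (lo - (j : Site 2)) (hi + (j : Site 2)) x).2 ℓs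
        (A (exitDir G φ w₀ R (lo - (j : Site 2)) (hi + (j : Site 2)) x).1))
        (A (exitDir G φ w₀ R (lo - (j : Site 2)) (hi + (j : Site 2)) x).1) (Rk (exitDir G φ w₀ R (lo - (j : Site 2)) (hi + (j : Site 2)) x).1)) := by
  have hx' : x ∈ outerBoundary (winGraph G w₀ R) (Win G φ w₀ (Finset.Icc (lo - (j : Site 2)) (hi + (j : Site 2))) R) := hx
  obtain ⟨-, -, hyP⟩ := inNbr_spec hx'
  have hty := (deepCtr_spec hstep (ℓs := ℓs) (M := M) hwide hyP).1
  rw [rectU]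
  refine nearSide_subset_innerBoundary hstep hfr hκ hℓs (hAℓ _) fun u hu v hv hvu => (winGraph_adj G).2 ⟨hvu.symm, ?_, ?_⟩
  · -- the face vertex is in the ball
    have huy := (rectU_geom hlip hstep hwide hA hK hx (by rw [rectU]; exact hu)).2.1
    exact graphBall_mono G w₀ (by omega) (BoxProdZ2.mem_graphBall_add G hnear huy)
  · -- the slab vertex is in the ball
    have hvt : v ∈ graphBall G (deepCtr G φ w₀ R (lo - (j : Site 2)) (hi + (j : Site 2)) ℓs M x) R' :=
      graphBall_mono G _ (hR' _) (cylBall_subset_prism G φ _ ℓs _ hv).1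
    have hvy := BoxProdZ2.mem_graphBall_add G hty hvt
    exact graphBall_mono G w₀ (by omega) (BoxProdZ2.mem_graphBall_add G hnear hvy)

/-! ## §4 The near side meets the near-contact face conditions; the assembled kit -/

/-- **The near side of the kit rectangle behind the deep slab meets the near-contact face conditions** of `Skelφ.kitOK_slabDeep`: for
`1 ≤ ℓs`, box sides `≥ 2T₀`, half-widths `A i k ≤ M`, `A i (oth i) ≤ ℓs`, reach `K`, `R' ≥ cylRadMax ℓs (ℓs + 2 + A i i + Rk i)`,
`ℓs + 2 + T₀ + K ≤ r₀ ≤ R`, `rs ≥ ℓs + 2 + T₀ + K`, `cU ≥ (Δ+1)^{Rk i}` — `sub` (near contact; planar via the shell box), `ball`, `adj` (the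
outward `Steps`-neighbour of a side vertex lies in the slab's cylinder ball `cylBall (deepCtr x) ℓs R'`, by `Frames` + (κ)), `card`, `one_le`.
[cite: KozmaNitzan2024, §4 p. 21 (U(P) ⊆ ∂Q, Q ⊆ S)] -/
theorem nearFaceOK_rect (hlip : Lip G φ) (hstep : Steps G φ) (hfr : Frames G φ types) (hκ : CylConn G φ types) {Δ : ℕ}
    (hΔ : ∀ v, G.degree v ≤ Δ) {R' r₀ rs cU : ℕ} (hℓs : 1 ≤ ℓs)
    (hwide : ∀ i, (lo - (j : Site 2)) i + 2 * tanOff ℓs M ≤ (hi + (j : Site 2)) i) (hA : ∀ i k, A i k ≤ M) (hAℓ : ∀ i, A i (oth i) ≤ ℓs)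
    (hK : ∀ i, ℓs + 1 + A i i + Rk i ≤ K) (hR' : ∀ i, cylRadMax G φ types ℓs (ℓs + 2 + A i i + Rk i) ≤ R')
    (hr₀ : ℓs + 2 + tanOff ℓs M + K ≤ r₀) (hR : r₀ ≤ R) (hrs : ℓs + 2 + tanOff ℓs M + K ≤ rs) (hcU : ∀ i, (Δ + 1) ^ Rk i ≤ cU) :
    NearFaceOKDeep G φ w₀ R lo hi j ℓs M R' r₀ rs cU (rectU hstep w₀ R lo hi j ℓs M A Rk) where
  sub x hx hnear := by
    intro u hu
    obtain ⟨-, huy, hφu⟩ := rectU_geom hlip hstep hwide hA hK hx hu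
    rw [mem_winLevel_iff]
    exact ⟨graphBall_mono G w₀ (by omega) (BoxProdZ2.mem_graphBall_add G hnear huy), SkelI.mem_Icc_of_mem_shell hφu⟩
  ball x hx _ u hu := graphBall_mono G x hrs (rectU_geom hlip hstep hwide hA hK hx hu).1
  adj x _ _ u hu := by
    rw [rectU] at hu
    obtain ⟨v, hv, hvu⟩ := exists_step_mem_cylBall_of_mem_nearSide hstep _ _ _ ℓs _ _ hfr hκ hℓs (hAℓ _) hu
    exact ⟨v, cylBall_mono G φ _ le_rfl (hR' _) hv, hvu⟩
  card x _ _ := by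
    rw [rectU, nearSide]
    exact (card_rside_le φ hΔ _ _ _ _ _).trans (hcU _)
  one_le := le_trans (Nat.one_le_pow _ _ (Nat.succ_pos _)) (hcU 0)

/-- **The deep slab kit with rectangle faces** (assembly of `Skelφ.kitOK_slabDeep` and `nearFaceOK_rect`): with `1 ≤ ℓs`, box sides `≥ 2T₀`,
half-widths `A i k ≤ M`, `A i (oth i) ≤ ℓs`, reach `K`, a cylinder-ball radius `R'` dominating `cylRadMax ℓs (ℓs + 2 + 2T₀)` (the slab region) and
`cylRadMax ℓs (ℓs + 2 + A i i + Rk i)` (the rungs into the face), `ℓs + 1 + T₀ + R' ≤ r₀`, `ℓs + 2 + T₀ + K ≤ r₀ ≤ R`, `rs ≥ ℓs + 2 + T₀ + R'`,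
`rs ≥ ℓs + 2 + T₀ + K`, `cU ≥ (Δ+1)^{Rk i}`:
`KitOK G φ w₀ R lo hi j rs ((Δ+1)^{R'} + (T₀ + 2)) cU (slabGeomDeep … (rectU …))` — the level-`j` seed kit of the D″ exploration whose
near-contact faces are near sides of band rectangles. [cite: KozmaNitzan2024, §4 p. 19 (Step III), p. 21 (Step IV geometry)] -/
theorem kitOK_slabRect (hlip : Lip G φ) (hstep : Steps G φ) (hfr : Frames G φ types) (hκ : CylConn G φ types) {Δ : ℕ}
    (hΔ : ∀ v, G.degree v ≤ Δ) {R' r₀ rs cU : ℕ} (hℓs : 1 ≤ ℓs)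
    (hwide : ∀ i, (lo - (j : Site 2)) i + 2 * tanOff ℓs M ≤ (hi + (j : Site 2)) i) (hA : ∀ i k, A i k ≤ M) (hAℓ : ∀ i, A i (oth i) ≤ ℓs)
    (hK : ∀ i, ℓs + 1 + A i i + Rk i ≤ K) (hR'₁ : cylRadMax G φ types ℓs (ℓs + 2 + 2 * tanOff ℓs M) ≤ R')
    (hR'₂ : ∀ i, cylRadMax G φ types ℓs (ℓs + 2 + A i i + Rk i) ≤ R')
    (hr₀₁ : ℓs + 1 + tanOff ℓs M + R' ≤ r₀) (hr₀₂ : ℓs + 2 + tanOff ℓs M + K ≤ r₀) (hR : r₀ ≤ R)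
    (hrs₁ : ℓs + 2 + tanOff ℓs M + R' ≤ rs) (hrs₂ : ℓs + 2 + tanOff ℓs M + K ≤ rs) (hcU : ∀ i, (Δ + 1) ^ Rk i ≤ cU) :
    KitOK G φ w₀ R lo hi j rs ((Δ + 1) ^ R' + (tanOff ℓs M + 2)) cU
      (slabGeomDeep G φ w₀ R lo hi j ℓs M R' r₀ (rectU hstep w₀ R lo hi j ℓs M A Rk)) := by
  refine kitOK_slabDeep hlip hstep hΔ hwide (fun c v hv => ?_) hr₀₁ hR hrs₁
    (nearFaceOK_rect hlip hstep hfr hκ hΔ hℓs hwide hA hAℓ hK hR'₂ hr₀₂ hR hrs₂ hcU)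
  exact cylBall_mono G φ c le_rfl hR'₁ (graphBall_inter_cyl_subset_cylBall' hfr hκ c hℓs (ℓs + 2 + 2 * tanOff ℓs M) hv)

end NearWin

end Skelφ

end Summit.CriticalPhenomena.PercolationContinuityZ3.Theorems.Transplant

end
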